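import Summits.ABC.IUTFork.Conditional.WRowFrey301327048AllLevels
import HarnessLib

/-!
# R-W WINDOW-TABLE «W:INHABITED-BANDS-B» — the abc triple `1 + 3¹⁶·7 = 2³·11·23·53³` at EVERY level: the hull licence S_H HOLDS at EVERY genuine
# Θ-volume datum over `(ratPoint (1/301327048), l)` for every `l` — the levels `5, 7` added to `WRowFrey301327048AllLevels`

PROOF-ONLY file (D-0012; 0 definitions, 0 `Prop` facts) of the abc-iut cell — D-0079 RESCUE sub-cell R-W «WINDOW Θ-SIDE INEQUALITY», W1 ROW
DECISIONS seat abc-iut-W-row-2 (gen 2), claim «W:INHABITED-BANDS-B» (abc-iut-plan rulings C-R75 / C-R77); sequel of `WRowFrey301327048AllLevels`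
(every prime `l ≥ 11`, fixed exponent `A_3 = 6`). The two remaining admissible levels `l = 5, 7` of the triple `1 + 3¹⁶·7 = 2³·11·23·53³` pass the same
certificate with the exponent `A_3 = 3` at the wild prime (`3³ = 27 ≤ e₀·(…)`; top-end cells evaluated at `L = 2, 3`), so the band closes to EVERY level:
**for every `l` and EVERY genuine Θ-volume datum `T` at `(ratPoint (1/301327048), l)` — no hypothesis on `l` at all (a datum carries `l` prime `≥ 5`,
[IUTchI] Def. 3.1 (c) / `InitialThetaData.five_le_l`, `PilotData.l_prime`) — the hull licence S_H HOLDS.** TAKES NO SIDE on [IUTchIII] Cor. 3.12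
(S. Mochizuki, *Inter-universal Teichmüller theory III*, Cor. 3.12 p. 173–174; Step (xi-f) p. 184) or on any author; «inhabited as typed» ≠ «asserted in print».

WHAT IS PROVED (namespace `Summit.ABC.IUTFork.Conditional`): `WRow.hcell_frey301327048_small` (the socket's arithmetic at `l ∈ {5, 7}`, `A_3 = 3`),
**`WRow.licence_frey301327048_every`** — for EVERY `l`, EVERY genuine Θ-volume datum `T` at `(ratPoint (1/301327048), l)` and EVERY pair of realising
Θ- and q-ideles, abc-iut-c312-1's `Thm311ToCor312.Licence` HOLDS at `settingPrVolSharp (pilotDataOfK T.D T.K) …`;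
**`WRow.exists_qPinned_and_hull_frey301327048_every`** — branch C's «∃ ρ qK, QPinned ∧ PilotKummerCompatHull» there, any columns. READING (neutral;
numbers, not adjectives): for this triple the typed window hypothesis S_H is DECIDED — INHABITED — AT EVERY LEVEL, hypothesis-free; no number-level and
no local-type hypothesis is consumed. Admissibility / (P6) / Szpiro-badness and NON-EMPTINESS of the datum type are NOT claimed. HONEST SCOPE: OUR sharp
containers; STRONGER-THAN-PRINT hull reading; nothing about the printed inequality or any author's intended hull; typed ≠ proved; instantiated ≠ endorsed;
no abc claim.
[cite: Mochizuki2012, IUTchI Def. 3.1 (b),(c) pp. 61–62, Rmk. 3.1.5 p. 65, Ex. 3.2 (iv) p. 71; IUTchIII Cor. 3.12 Step (xi-f) p. 184; IUTchIV Prop. 1.1 p. 9, Prop. 1.2 (i)(ii) p. 10, Prop. 1.4 (ii) p. 13, Cor. 2.2 (ii) proof (P5) p. 46]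
[cite: DupuyHilado2025, §3.3, §3.4, §4.9, §4.12] [cite: NeukirchANT1999, Ch. II (5.5)–(5.7)] [cite: SilvermanAEC2009, Prop. III.1.7(b)] [claim: Mochizuki2012, status: disputed] for every IUT sentence.
-/

noncomputable section

open Set Function Metric NumberField IsDedekindDomain

namespace Summit.ABC.IUTFork.Conditional

open Thm311 Thm311.Real Cor312 Cor312Vol Cor312Prov Literature.IUT.LogThetaLattice Literature.IUT.LogVolume
  Literature.IUT.HodgeTheaters Literature.IUT.LogVolume.Cor22
open Literature.NumberTheory.NumberFields Literature.NumberTheory.GaloisRepresentations.Ultrametric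
open Literature.NumberTheory.DiophantineGeometry Literature.NumberTheory.DiophantineGeometry.GenEll

/-! ## The arithmetic at the levels `l = 5, 7` (exponent `A_3 = 3`) -/

/-- **The socket's arithmetic hypothesis `hcell` for `(1, 3¹⁶·7, 2³·11·23·53³)` at the levels `l ∈ {5, 7}`** (exponents A_3 = 3, A_7 = A_11 = A_23 = 0,
A_53 = 1; end cells evaluated). [folklore] -/
theorem WRow.hcell_frey301327048_small {l : ℕ} (hl : l.Prime) (hl57 : l = 5 ∨ l = 7) :
    ∀ p : ℕ, p.Prime → p ∣ 1 * 301327047 * 301327048 → p ≠ 2 → p ≠ l → ∀ e : ℕ, 0 < e → l ∣ e →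
      15 * l ∣ e * (1 * 301327047 * 301327048).factorization p → (p ∣ 30 → (p - 1) ∣ e) →
      (p ∣ 301327048 → Odd ((1 * 301327047 * 301327048).factorization p) → 30 * l ∣ e * (1 * 301327047 * 301327048).factorization p) →
      (∀ k : ℕ, (e : ℤ) ≠ (p : ℤ) ^ k * ((p : ℤ) - 1)) ∧
      ∀ i : ℕ, i < (l - 1) / 2 →
        (e : ℤ) * ((((i + 1 : ℕ) : ℤ) ^ 2 * ((e * (2 * (1 * 301327047 * 301327048).factorization p) / (2 * l) : ℕ) : ℤ) -
            ((i + 1 : ℕ) : ℤ) * (((if p ∣ 30 ∧ ¬ p ∣ (1 * 301327047 * 301327048).factorization p then 2 * e - 1 else e - 1 : ℕ) : ℕ) : ℤ) -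
            ((i + 2 : ℕ) : ℤ) * (if p ∣ 30 then (((e / (p - 1) : ℕ) : ℤ)) else (1 : ℤ))) / (e : ℤ)) +
          ((i + 2 : ℕ) : ℤ) * min ((p : ℤ) ^ (if p = 3 then 3 else if p = 53 then 1 else 0) - ((if p = 3 then 3 else if p = 53 then 1 else 0 : ℕ) : ℤ) * (e : ℤ))
            ((p : ℤ) ^ (if p = 3 then 4 else if p = 53 then 2 else 1) - ((if p = 3 then 4 else if p = 53 then 2 else 1 : ℕ) : ℤ) * (e : ℤ)) ≤
        ((e * (2 * (1 * 301327047 * 301327048).factorization p) / (2 * l) : ℕ) : ℤ) := by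
  intro p hp hpabc h2 hpl e he _hle h15 h30 hodd
  rcases eq_of_prime_dvd_triple_301327048 hp hpabc with rfl | rfl | rfl | rfl | rfl | rfl
  · exact absurd rfl h2
  · -- `p = 3`: `v_3(abc) = 16`, admissible `e = 30·l·n`, `A = 3`
    rw [factorization_triple_301327048.1] at h15 hodd ⊢
    have hcopv : Nat.Coprime (15 * l) 16 :=
      Nat.Coprime.mul_left (by norm_num) (by simpa using ((Nat.coprime_primes hl (by norm_num : Nat.Prime 2)).mpr (by omega)).pow_right 4)
    have hA : 15 * l ∣ e := hcopv.dvd_of_dvd_mul_right h15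
    have hq : 2 ∣ e := by have := h30 (by norm_num); norm_num at this; exact this
    have hcopq : Nat.Coprime 2 (15 * l) :=
      Nat.Coprime.mul_right (by norm_num) ((Nat.coprime_primes (by norm_num) hl).mpr (by omega))
    have he0 : 30 * l ∣ e := by
      have := Nat.Coprime.mul_dvd_of_dvd_of_dvd hcopq hq hA; rwa [← mul_assoc, show (2 : ℕ) * 15 = 30 by norm_num] at this
    obtain ⟨n, rfl⟩ := he0
    have hn : 1 ≤ n := Nat.pos_of_ne_zero (by rintro rfl; simp at he)
    refine ⟨WRow.natCast_ne_pow_mul_sub_one (by norm_num : Nat.Prime 5) (by norm_num) (by norm_num) (by norm_num)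
      ⟨6 * l * n, by ring⟩, fun i hi => ?_⟩
    rw [if_pos ⟨by norm_num, by norm_num⟩, if_pos (by norm_num : (3 : ℕ) ∣ 30)]
    simp only [ite_true]
    refine WRow.cell_wild_of_ends ((3 : ℕ) : ℤ) (30 * l) (3 - 1) (2 * 16) (2 * l) 3 4 ((l - 1) / 2) (by norm_num) (by norm_num)
      (Dvd.dvd.mul_right (by norm_num) l) (by omega) ⟨480, by ring⟩ (by omega) ?_ hi hn
    have hP : 30 * l * (2 * 16) / (2 * l) = 480 := Nat.div_eq_of_eq_mul_left (by omega) (by ring)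
    have hR : 30 * l / (3 - 1) = 15 * l := by omega
    have hpA : (((3 : ℕ) : ℤ)) ^ 3 = 27 := by norm_num
    rintro i (rfl | hi')
    · rw [hP, hR, hpA]; push_cast; omega
    · obtain ⟨k, hk⟩ := hl.odd_of_ne_two (by omega)
      have hl' : l = 2 * i + 3 := by omega
      subst hl'
      have hi12 : i = 1 ∨ i = 2 := by omega
      rcases hi12 with rfl | rfl <;> (rw [hP, hR, hpA]; norm_num)
  · -- `p = 7`: `v_7(abc) = 1`, admissible `e = 15·l·n`, `A = 0`
    rw [factorization_triple_301327048.2.1] at h15 hodd ⊢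
    have hA : 15 * l ∣ e := by simpa using h15
    obtain ⟨n, rfl⟩ := hA
    have hn : 1 ≤ n := Nat.pos_of_ne_zero (by rintro rfl; simp at he)
    refine ⟨WRow.natCast_ne_pow_mul_sub_one (by norm_num : Nat.Prime 5) (by norm_num) (by norm_num) (by norm_num)
      ⟨3 * l * n, by ring⟩, fun i hi => ?_⟩
    rw [if_neg (by norm_num : ¬ ((7 : ℕ) ∣ 30 ∧ ¬ (7 : ℕ) ∣ 1)), if_neg (by norm_num : ¬ (7 : ℕ) ∣ 30)]
    simp only [show ((7 : ℕ) = 3) = False from eq_false (by decide), ite_false]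
    refine WRow.cell_tame_of_ends ((7 : ℕ) : ℤ) (15 * l) (2 * 1) (2 * l) 0 1 ((l - 1) / 2) (by norm_num) (by omega)
      ⟨15, by ring⟩ (by omega) ?_ hi hn
    have hP : 15 * l * (2 * 1) / (2 * l) = 15 := Nat.div_eq_of_eq_mul_left (by omega) (by ring)
    have hpA : (((7 : ℕ) : ℤ)) ^ 0 = 1 := by norm_num
    rintro i (rfl | hi')
    · rw [hP, hpA]; push_cast; omega
    · obtain ⟨k, hk⟩ := hl.odd_of_ne_two (by omega)
      have hl' : l = 2 * i + 3 := by omega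
      subst hl'
      have hi12 : i = 1 ∨ i = 2 := by omega
      rcases hi12 with rfl | rfl <;> (rw [hP, hpA]; norm_num)
  · -- `p = 11`: `v_11(abc) = 1`, admissible `e = 30·l·n`, `A = 0`
    rw [factorization_triple_301327048.2.2.1] at h15 hodd ⊢
    have hT : 30 * l ∣ e := by simpa using hodd (by norm_num) (by decide)
    obtain ⟨n, rfl⟩ := hT
    have hn : 1 ≤ n := Nat.pos_of_ne_zero (by rintro rfl; simp at he)
    refine ⟨WRow.natCast_ne_pow_mul_sub_one (by norm_num : Nat.Prime 3) (by norm_num) (by norm_num) (by norm_num)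
      ⟨10 * l * n, by ring⟩, fun i hi => ?_⟩
    rw [if_neg (by norm_num : ¬ ((11 : ℕ) ∣ 30 ∧ ¬ (11 : ℕ) ∣ 1)), if_neg (by norm_num : ¬ (11 : ℕ) ∣ 30)]
    simp only [show ((11 : ℕ) = 3) = False from eq_false (by decide), ite_false]
    refine WRow.cell_tame_of_ends ((11 : ℕ) : ℤ) (30 * l) (2 * 1) (2 * l) 0 1 ((l - 1) / 2) (by norm_num) (by omega)
      ⟨30, by ring⟩ (by omega) ?_ hi hn
    have hP : 30 * l * (2 * 1) / (2 * l) = 30 := Nat.div_eq_of_eq_mul_left (by omega) (by ring)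
    have hpA : (((11 : ℕ) : ℤ)) ^ 0 = 1 := by norm_num
    rintro i (rfl | hi')
    · rw [hP, hpA]; push_cast; omega
    · obtain ⟨k, hk⟩ := hl.odd_of_ne_two (by omega)
      have hl' : l = 2 * i + 3 := by omega
      subst hl'
      have hi12 : i = 1 ∨ i = 2 := by omega
      rcases hi12 with rfl | rfl <;> (rw [hP, hpA]; norm_num)
  · -- `p = 23`: `v_23(abc) = 1`, admissible `e = 30·l·n`, `A = 0`
    rw [factorization_triple_301327048.2.2.2.1] at h15 hodd ⊢
    have hT : 30 * l ∣ e := by simpa using hodd (by norm_num) (by decide)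
    obtain ⟨n, rfl⟩ := hT
    have hn : 1 ≤ n := Nat.pos_of_ne_zero (by rintro rfl; simp at he)
    refine ⟨WRow.natCast_ne_pow_mul_sub_one (by norm_num : Nat.Prime 5) (by norm_num) (by norm_num) (by norm_num)
      ⟨6 * l * n, by ring⟩, fun i hi => ?_⟩
    rw [if_neg (by norm_num : ¬ ((23 : ℕ) ∣ 30 ∧ ¬ (23 : ℕ) ∣ 1)), if_neg (by norm_num : ¬ (23 : ℕ) ∣ 30)]
    simp only [show ((23 : ℕ) = 3) = False from eq_false (by decide), ite_false]
    refine WRow.cell_tame_of_ends ((23 : ℕ) : ℤ) (30 * l) (2 * 1) (2 * l) 0 1 ((l - 1) / 2) (by norm_num) (by omega)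
      ⟨30, by ring⟩ (by omega) ?_ hi hn
    have hP : 30 * l * (2 * 1) / (2 * l) = 30 := Nat.div_eq_of_eq_mul_left (by omega) (by ring)
    have hpA : (((23 : ℕ) : ℤ)) ^ 0 = 1 := by norm_num
    rintro i (rfl | hi')
    · rw [hP, hpA]; push_cast; omega
    · obtain ⟨k, hk⟩ := hl.odd_of_ne_two (by omega)
      have hl' : l = 2 * i + 3 := by omega
      subst hl'
      have hi12 : i = 1 ∨ i = 2 := by omega
      rcases hi12 with rfl | rfl <;> (rw [hP, hpA]; norm_num)
  · -- `p = 53`: `v_53(abc) = 3`, admissible `e = 10·l·n`, `A = 1`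
    rw [factorization_triple_301327048.2.2.2.2] at h15 hodd ⊢
    have hT : 10 * l ∣ e := by
      have h := hodd (by norm_num) (by decide)
      rw [show 30 * l = 10 * l * 3 by ring, show e * 3 = e * 1 * 3 by ring] at h
      have h' := Nat.dvd_of_mul_dvd_mul_right (by norm_num) h
      simpa using h'
    obtain ⟨n, rfl⟩ := hT
    have hn : 1 ≤ n := Nat.pos_of_ne_zero (by rintro rfl; simp at he)
    refine ⟨WRow.natCast_ne_pow_mul_sub_one (by norm_num : Nat.Prime 5) (by norm_num) (by norm_num) (by norm_num)
      ⟨2 * l * n, by ring⟩, fun i hi => ?_⟩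
    rw [if_neg (by norm_num : ¬ ((53 : ℕ) ∣ 30 ∧ ¬ (53 : ℕ) ∣ 3)), if_neg (by norm_num : ¬ (53 : ℕ) ∣ 30)]
    simp only [show ((53 : ℕ) = 3) = False from eq_false (by decide), ite_true, ite_false]
    refine WRow.cell_tame_of_ends ((53 : ℕ) : ℤ) (10 * l) (2 * 3) (2 * l) 1 2 ((l - 1) / 2) (by norm_num) (by omega)
      ⟨30, by ring⟩ (by omega) ?_ hi hn
    have hP : 10 * l * (2 * 3) / (2 * l) = 30 := Nat.div_eq_of_eq_mul_left (by omega) (by ring)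
    have hpA : (((53 : ℕ) : ℤ)) ^ 1 = 53 := by norm_num
    rintro i (rfl | hi')
    · rw [hP, hpA]; push_cast; omega
    · obtain ⟨k, hk⟩ := hl.odd_of_ne_two (by omega)
      have hl' : l = 2 * i + 3 := by omega
      subst hl'
      have hi12 : i = 1 ∨ i = 2 := by omega
      rcases hi12 with rfl | rfl <;> (rw [hP, hpA]; norm_num)

/-! ## THE BAND CLOSED: S_H INHABITED at every genuine datum over `(ratPoint (1/301327048), l)`, EVERY level `l` -/

/-- **«W:INHABITED-BANDS-B», `1 + 3¹⁶·7 = 2³·11·23·53³`: for EVERY level `l`** (no hypothesis: a genuine datum has `l` prime and `≥ 5`), every genuine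
Θ-volume datum `T` at `(ratPoint (1/301327048), l)` and every pair of Θ- and q-ideles realising the pilot divisors of `X := pilotDataOfK T.D T.K`,
abc-iut-c312-1's `Thm311ToCor312.Licence` HOLDS at abc-iut-c312-7's `settingPrVolSharp X …` — `WRow.licence_frey301327048_all` for `l ≥ 11`,
abc-iut-W-row-1's `WRow.licence_triple_unconditional` at `WRow.hcell_frey301327048_small` for `l ∈ {5, 7}`.
[cite: Mochizuki2012, IUTchI Def. 3.1 (b),(c) pp. 61–62, Rmk. 3.1.5 p. 65, Ex. 3.2 (iv) p. 71; IUTchIII Cor. 3.12 Step (xi-f) p. 184; IUTchIV Prop. 1.1 p. 9, Prop. 1.2 (i)(ii) p. 10, Prop. 1.4 (ii) p. 13, Cor. 2.2 (ii) proof (P5) p. 46] [cite: DupuyHilado2025, §3.3, §3.4, §4.9, §4.12] [claim: Mochizuki2012, status: disputed] -/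
theorem WRow.licence_frey301327048_every (l : ℕ) (T : Cor22.ThetaVolumeDatumAt (ratPoint (((1 : ℕ) : ℚ) / (301327048 : ℕ))) l) :
    letI := T.instFieldF; letI := T.instNumberFieldF; letI := T.instAlgebraF; letI := T.instFieldK
    letI := T.instNumberFieldK; letI := T.instAlgebraK; letI := T.instFieldFbar; letI := T.instAlgebraFbar
    letI := T.instAlgebraKFbar; letI := T.instIsElliptic
    ∀ {logv : PadicLogs T.K} (hlog : LogvAnalytic logv) (M : Type) [Field M] [NumberField M]
      (archPk : ∀ (j : (thetaIndex (pilotDataOfK T.D T.K)).Label) (vQ : (thetaIndex (pilotDataOfK T.D T.K)).VQ),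
        Set ((logShellsDH (pilotDataOfK T.D T.K) logv).Packet j vQ))
      (archSub : ∀ (j : (thetaIndex (pilotDataOfK T.D T.K)).Label) (v : (thetaIndex (pilotDataOfK T.D T.K)).V),
        Set ((logShellsDH (pilotDataOfK T.D T.K) logv).Packet j ((thetaIndex (pilotDataOfK T.D T.K)).over v)))
      (Ψ : ℤ → ∀ v : (thetaIndex (pilotDataOfK T.D T.K)).V, v ∈ (thetaIndex (pilotDataOfK T.D T.K)).Vbad →
        Set ((logShellsDH (pilotDataOfK T.D T.K) logv).StarPacket v))
      (act : ℤ → ∀ v : (thetaIndex (pilotDataOfK T.D T.K)).V, v ∈ (thetaIndex (pilotDataOfK T.D T.K)).Vbad →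
        (logShellsDH (pilotDataOfK T.D T.K) logv).StarPacket v → Module.End ℚ ((logShellsDH (pilotDataOfK T.D T.K) logv).StarPacket v))
      (Mmod : ℤ → ∀ j : (thetaIndex (pilotDataOfK T.D T.K)).LabelStar, Set ((logShellsDH (pilotDataOfK T.D T.K) logv).GlobalPacket j.1))
      (region : ℤ → ∀ j : (thetaIndex (pilotDataOfK T.D T.K)).LabelStar, FinDivisor M → ∀ vQ : (thetaIndex (pilotDataOfK T.D T.K)).VQ,
        Set ((logShellsDH (pilotDataOfK T.D T.K) logv).Packet j.1 vQ))
      (n : ℤ) {HT : Type} {LogLink : HT → HT → Type} {IsFull : ∀ {s t : HT}, LogLink s t → Prop}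
      (lat : LGPGaussianLogThetaLattice LogLink IsFull)
      {Frd : Type} {IsoF : Frd → Frd → Type} {Ob : Frd → Type} {realify : Frd → Frd} {Strip : Type}
      {IsoS : Strip → Strip → Type} {Mv : ∀ v : (thetaIndex (pilotDataOfK T.D T.K)).V, v ∈ (thetaIndex (pilotDataOfK T.D T.K)).Vbad → Type}
      [∀ v h, Monoid (Mv v h)]
      (sig : GlobalLGPFrobenioidSignature (thetaIndex (pilotDataOfK T.D T.K)).lstar (thetaIndex (pilotDataOfK T.D T.K)).V
        (· ∈ (thetaIndex (pilotDataOfK T.D T.K)).Vbad) Frd IsoF Ob realify Strip IsoS Mv)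
      (split : SplittingMonoids Mv) {ObΔ : Type} {N : ∀ v : (thetaIndex (pilotDataOfK T.D T.K)).V, v ∈ (thetaIndex (pilotDataOfK T.D T.K)).Vbad → Type}
      [∀ v h, Monoid (N v h)] (qData : QPilotData ObΔ N)
      (tq : ∀ (pp : Nat.Primes) (x : (thetaIndex (pilotDataOfK T.D T.K)).Fibre (.inr pp)),
        haveI : Fact (pp : ℕ).Prime := ⟨pp.2⟩; kOf (pilotDataOfK T.D T.K) pp.1 x)
      (t : ∀ (pp : Nat.Primes) (_ : Fin (pilotDataOfK T.D T.K).lstar) (x : (thetaIndex (pilotDataOfK T.D T.K)).Fibre (.inr pp)),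
        haveI : Fact (pp : ℕ).Prime := ⟨pp.2⟩; kOf (pilotDataOfK T.D T.K) pp.1 x)
      (htq0 : ∀ pp x, tq pp x ≠ 0)
      (htq1 : ∀ (pp : Nat.Primes) (x : (thetaIndex (pilotDataOfK T.D T.K)).Fibre (.inr pp)),
        haveI : Fact (pp : ℕ).Prime := ⟨pp.2⟩; placeOf (pilotDataOfK T.D T.K) pp.1 x ∉ (pilotDataOfK T.D T.K).S → ‖tq pp x‖ = 1)
      (_ht0 : ∀ pp i x, t pp i x ≠ 0)
      (_ht : ∀ (pp : Nat.Primes) (i : Fin (pilotDataOfK T.D T.K).lstar) (x : (thetaIndex (pilotDataOfK T.D T.K)).Fibre (.inr pp)),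
        haveI : Fact (pp : ℕ).Prime := ⟨pp.2⟩
        Real.log ‖t pp i x‖ = -((pilotDataOfK T.D T.K).thetaPilot i (placeOf (pilotDataOfK T.D T.K) pp.1 x)) *
          logNorm T.K (placeOf (pilotDataOfK T.D T.K) pp.1 x) / localDegree T.K (placeOf (pilotDataOfK T.D T.K) pp.1 x))
      (_htq : ∀ (pp : Nat.Primes) (x : (thetaIndex (pilotDataOfK T.D T.K)).Fibre (.inr pp)),
        haveI : Fact (pp : ℕ).Prime := ⟨pp.2⟩
        Real.log ‖tq pp x‖ = -((pilotDataOfK T.D T.K).qPilot (placeOf (pilotDataOfK T.D T.K) pp.1 x)) *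
          logNorm T.K (placeOf (pilotDataOfK T.D T.K) pp.1 x) / localDegree T.K (placeOf (pilotDataOfK T.D T.K) pp.1 x)),
      Thm311ToCor312.Licence
        (settingPrVolSharp (pilotDataOfK T.D T.K) hlog M archPk archSub Ψ act Mmod region n lat sig split qData tq t htq0 htq1) := by
  letI := T.instFieldF; letI := T.instNumberFieldF; letI := T.instAlgebraF; letI := T.instFieldK
  letI := T.instNumberFieldK; letI := T.instAlgebraK; letI := T.instFieldFbar; letI := T.instAlgebraFbar
  letI := T.instAlgebraKFbar; letI := T.instIsElliptic
  intro logv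
  have hl : l.Prime := by simpa [pilotDataOfK_l] using (pilotDataOfK T.D T.K).l_prime
  have hl5 : 5 ≤ l := T.D.five_le_l
  by_cases h11 : 11 ≤ l
  · exact WRow.licence_frey301327048_all l hl h11 T
  · have hl57 : l = 5 ∨ l = 7 := by
      interval_cases l
      · exact Or.inl rfl
      · exact absurd hl (by norm_num)
      · exact Or.inr rfl
      · exact absurd hl (by norm_num)
      · exact absurd hl (by norm_num)
      · exact absurd hl (by norm_num)
    exact WRow.licence_triple_unconditional isABCTriple_frey301327048 (by rw [Cor22.jInv_ratPoint_triple isABCTriple_frey301327048]; norm_num) T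
      (fun p => if p = 3 then 3 else if p = 53 then 1 else 0) (fun p => if p = 3 then 4 else if p = 53 then 2 else 1) (WRow.hcell_frey301327048_small hl hl57)

/-- **BRANCH C's PER-DATUM ANTECEDENT «∃ ρ qK, QPinned ∧ PilotKummerCompatHull» at every genuine datum over `(ratPoint (1/301327048), l)`, EVERY
level `l`** (any columns `col`; every pair of realising Θ- and q-ideles): the per-datum S_H object of the certificates of record (p453137 / p450130 /
p447945) HOLDS at every datum class of this triple, UNCONDITIONALLY and at every level.
[cite: Mochizuki2012, IUTchIII Cor. 3.12 Step (xi-d) p. 183, (xi-f) p. 184] [cite: DupuyHilado2025, §3.3, §3.4, §4.9] [claim: Mochizuki2012, status: disputed] -/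
theorem WRow.exists_qPinned_and_hull_frey301327048_every (l : ℕ) (T : Cor22.ThetaVolumeDatumAt (ratPoint (((1 : ℕ) : ℚ) / (301327048 : ℕ))) l) :
    letI := T.instFieldF; letI := T.instNumberFieldF; letI := T.instAlgebraF; letI := T.instFieldK
    letI := T.instNumberFieldK; letI := T.instAlgebraK; letI := T.instFieldFbar; letI := T.instAlgebraFbar
    letI := T.instAlgebraKFbar; letI := T.instIsElliptic
    ∀ {logv : PadicLogs T.K} (hlog : LogvAnalytic logv) (M : Type) [Field M] [NumberField M]
      (archPk : ∀ (j : (thetaIndex (pilotDataOfK T.D T.K)).Label) (vQ : (thetaIndex (pilotDataOfK T.D T.K)).VQ),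
        Set ((logShellsDH (pilotDataOfK T.D T.K) logv).Packet j vQ))
      (archSub : ∀ (j : (thetaIndex (pilotDataOfK T.D T.K)).Label) (v : (thetaIndex (pilotDataOfK T.D T.K)).V),
        Set ((logShellsDH (pilotDataOfK T.D T.K) logv).Packet j ((thetaIndex (pilotDataOfK T.D T.K)).over v)))
      (Ψ : ℤ → ∀ v : (thetaIndex (pilotDataOfK T.D T.K)).V, v ∈ (thetaIndex (pilotDataOfK T.D T.K)).Vbad →
        Set ((logShellsDH (pilotDataOfK T.D T.K) logv).StarPacket v))
      (act : ℤ → ∀ v : (thetaIndex (pilotDataOfK T.D T.K)).V, v ∈ (thetaIndex (pilotDataOfK T.D T.K)).Vbad →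
        (logShellsDH (pilotDataOfK T.D T.K) logv).StarPacket v → Module.End ℚ ((logShellsDH (pilotDataOfK T.D T.K) logv).StarPacket v))
      (Mmod : ℤ → ∀ j : (thetaIndex (pilotDataOfK T.D T.K)).LabelStar, Set ((logShellsDH (pilotDataOfK T.D T.K) logv).GlobalPacket j.1))
      (region : ℤ → ∀ j : (thetaIndex (pilotDataOfK T.D T.K)).LabelStar, FinDivisor M → ∀ vQ : (thetaIndex (pilotDataOfK T.D T.K)).VQ,
        Set ((logShellsDH (pilotDataOfK T.D T.K) logv).Packet j.1 vQ))
      (n : ℤ) {HT : Type} {LogLink : HT → HT → Type} {IsFull : ∀ {s t : HT}, LogLink s t → Prop}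
      (lat : LGPGaussianLogThetaLattice LogLink IsFull)
      {Frd : Type} {IsoF : Frd → Frd → Type} {Ob : Frd → Type} {realify : Frd → Frd} {Strip : Type}
      {IsoS : Strip → Strip → Type} {Mv : ∀ v : (thetaIndex (pilotDataOfK T.D T.K)).V, v ∈ (thetaIndex (pilotDataOfK T.D T.K)).Vbad → Type}
      [∀ v h, Monoid (Mv v h)]
      (sig : GlobalLGPFrobenioidSignature (thetaIndex (pilotDataOfK T.D T.K)).lstar (thetaIndex (pilotDataOfK T.D T.K)).V
        (· ∈ (thetaIndex (pilotDataOfK T.D T.K)).Vbad) Frd IsoF Ob realify Strip IsoS Mv)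
      (split : SplittingMonoids Mv) {ObΔ : Type} {N : ∀ v : (thetaIndex (pilotDataOfK T.D T.K)).V, v ∈ (thetaIndex (pilotDataOfK T.D T.K)).Vbad → Type}
      [∀ v h, Monoid (N v h)] (qData : QPilotData ObΔ N)
      (tq : ∀ (pp : Nat.Primes) (x : (thetaIndex (pilotDataOfK T.D T.K)).Fibre (.inr pp)),
        haveI : Fact (pp : ℕ).Prime := ⟨pp.2⟩; kOf (pilotDataOfK T.D T.K) pp.1 x)
      (t : ∀ (pp : Nat.Primes) (_ : Fin (pilotDataOfK T.D T.K).lstar) (x : (thetaIndex (pilotDataOfK T.D T.K)).Fibre (.inr pp)),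
        haveI : Fact (pp : ℕ).Prime := ⟨pp.2⟩; kOf (pilotDataOfK T.D T.K) pp.1 x)
      (htq0 : ∀ pp x, tq pp x ≠ 0)
      (htq1 : ∀ (pp : Nat.Primes) (x : (thetaIndex (pilotDataOfK T.D T.K)).Fibre (.inr pp)),
        haveI : Fact (pp : ℕ).Prime := ⟨pp.2⟩; placeOf (pilotDataOfK T.D T.K) pp.1 x ∉ (pilotDataOfK T.D T.K).S → ‖tq pp x‖ = 1)
      (col : ℤ → Column (logShellsDH (pilotDataOfK T.D T.K) logv))
      (_ht0 : ∀ pp i x, t pp i x ≠ 0)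
      (_ht : ∀ (pp : Nat.Primes) (i : Fin (pilotDataOfK T.D T.K).lstar) (x : (thetaIndex (pilotDataOfK T.D T.K)).Fibre (.inr pp)),
        haveI : Fact (pp : ℕ).Prime := ⟨pp.2⟩
        Real.log ‖t pp i x‖ = -((pilotDataOfK T.D T.K).thetaPilot i (placeOf (pilotDataOfK T.D T.K) pp.1 x)) *
          logNorm T.K (placeOf (pilotDataOfK T.D T.K) pp.1 x) / localDegree T.K (placeOf (pilotDataOfK T.D T.K) pp.1 x))
      (_htq : ∀ (pp : Nat.Primes) (x : (thetaIndex (pilotDataOfK T.D T.K)).Fibre (.inr pp)),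
        haveI : Fact (pp : ℕ).Prime := ⟨pp.2⟩
        Real.log ‖tq pp x‖ = -((pilotDataOfK T.D T.K).qPilot (placeOf (pilotDataOfK T.D T.K) pp.1 x)) *
          logNorm T.K (placeOf (pilotDataOfK T.D T.K) pp.1 x) / localDegree T.K (placeOf (pilotDataOfK T.D T.K) pp.1 x)),
      ∃ (ρ : (∀ v : (thetaIndex (pilotDataOfK T.D T.K)).V, v ∈ (thetaIndex (pilotDataOfK T.D T.K)).Vbad →
              Set ((logShellsDH (pilotDataOfK T.D T.K) logv).StarPacket v)) →
            ∀ (j : (thetaIndex (pilotDataOfK T.D T.K)).Label) (vQ : (thetaIndex (pilotDataOfK T.D T.K)).VQ),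
              Set ((logShellsDH (pilotDataOfK T.D T.K) logv).Packet j vQ))
          (qK : ∀ v : (thetaIndex (pilotDataOfK T.D T.K)).V, v ∈ (thetaIndex (pilotDataOfK T.D T.K)).Vbad →
            Set ((logShellsDH (pilotDataOfK T.D T.K) logv).StarPacket v)),
          QPinned ({ toSituation := situationPrVol (pilotDataOfK T.D T.K) hlog M archPk archSub Ψ act Mmod region, col := col } :
              LatticeSituation (thetaIndex (pilotDataOfK T.D T.K)))
            (settingPrVolSharp (pilotDataOfK T.D T.K) hlog M archPk archSub Ψ act Mmod region n lat sig split qData tq t htq0 htq1) ρ qK ∧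
          PilotKummerCompatHull ({ toSituation := situationPrVol (pilotDataOfK T.D T.K) hlog M archPk archSub Ψ act Mmod region, col := col } :
              LatticeSituation (thetaIndex (pilotDataOfK T.D T.K)))
            (settingPrVolSharp (pilotDataOfK T.D T.K) hlog M archPk archSub Ψ act Mmod region n lat sig split qData tq t htq0 htq1) ρ qK := by
  letI := T.instFieldF; letI := T.instNumberFieldF; letI := T.instAlgebraF; letI := T.instFieldK
  letI := T.instNumberFieldK; letI := T.instAlgebraK; letI := T.instFieldFbar; letI := T.instAlgebraFbar
  letI := T.instAlgebraKFbar; letI := T.instIsElliptic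
  intro logv
  have hl : l.Prime := by simpa [pilotDataOfK_l] using (pilotDataOfK T.D T.K).l_prime
  have hl5 : 5 ≤ l := T.D.five_le_l
  by_cases h11 : 11 ≤ l
  · exact WRow.exists_qPinned_and_hull_frey301327048_all l hl h11 T
  · have hl57 : l = 5 ∨ l = 7 := by
      interval_cases l
      · exact Or.inl rfl
      · exact absurd hl (by norm_num)
      · exact Or.inr rfl
      · exact absurd hl (by norm_num)
      · exact absurd hl (by norm_num)
      · exact absurd hl (by norm_num)
    exact WRow.exists_qPinned_and_hull_triple_unconditional isABCTriple_frey301327048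
      (by rw [Cor22.jInv_ratPoint_triple isABCTriple_frey301327048]; norm_num) T (fun p => if p = 3 then 3 else if p = 53 then 1 else 0) (fun p => if p = 3 then 4 else if p = 53 then 2 else 1) (WRow.hcell_frey301327048_small hl hl57)

end Summit.ABC.IUTFork.Conditional

end
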